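import Summits.Ventures.CertifiedArithmetic.LowPrec.SRDyadicGridP3109
import HarnessLib

/-!
# The threshold table, row by row: `Thresholds φ L J P I₁ I₂` for the OCP, IEEE and P3109 formats

HONEST FRAMING: certified error envelopes and provably optimal rounding/accumulation schemes for
low-precision formats under stated cost models; every table by two implementations; no hardware or
vendor claims.

File LXXXVII of the SR slice.  File LXXXVI packaged the exact random-bit thresholds of the P3109
stochastic modes on a value set as one proposition `Thresholds φ L J P I₁ I₂` (trees exact from `L`
bits and `L` attained; product rounding `P`-bit with `J` attained by `quantum²`; one-stage inner
products exact from `I₁ = L + J`, attained; two-stage exact from `I₂ = max L P`) and instantiated it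
for the P3109 `binary8pP` formats and the OCP FP8 pair.  This file completes the published summary
table (`THEOREMS-R3.md` §7s, `paper/sr.tex` "Summary: exact random-bit thresholds"): every
one-format row is ONE kernel-checked instance —

| format | `L` | `J` | `P` | `I₁` | `I₂` | theorem |
|---|---|---|---|---|---|---|
| E3M2 (OCP FP6) | 6 | 4 | 4 | 10 | 6 | `e3m2_thresholds` |
| E2M3 (OCP FP6) | 2 | 3 | 4 | 5 | 4 | `e2m3_thresholds` |
| E4M3 (OCP FP8) | 14 | 9 | 9 | 23 | 14 | `ocp_fp8_thresholds` (LXXXVI) |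
| E5M2 (OCP FP8) | 29 | 16 | 16 | 45 | 29 | `ocp_fp8_thresholds` (LXXXVI) |
| binary16 | 29 | 24 | 24 | 53 | 29 | `binary16_thresholds` |
| bfloat16 | 253 | 133 | 133 | 386 | 253 | `bfloat16_thresholds` |
| binary32 | 253 | 149 | 149 | 402 | 253 | `binary32_thresholds` |
| binary8p3 / 8p4 / 8p5 | 30 / 14 / 6 | 17 / 10 / 7 | 17 / 10 / 7 | 47 / 24 / 13 | 30 / 14 / 7 | LXXXVI |

(E2M1, `bias + m = 2`, is outside the generic hypothesis `bias + m ≥ 3`; its row `2, 1, 2, 3, 2` is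
the kernel certificate of files LXXVII/LXXVIII and `prod_law_normal_formats`.)  For E2M3 note
`P = 4 > J = 3` and `I₂ = 4 > L = 2`: as for `binary8p5`, the product rounding binds, here through
the NORMAL term `m + 1 = 4` (attained, `prod_law_normal_formats`).
-/

namespace Summit.Ventures.CertifiedArithmetic.LowPrec.SR.LimitedBits

open Literature.ComputerArithmetic.P3109
open Literature.ComputerArithmetic.ConnollyHighamMary2021
open Literature.ComputerArithmetic.FloatingPoint (Format MiniFloat)
open Literature.ComputerArithmetic.FloatingPoint.MiniFloat (valueSet valueSet_nonempty)
open Summit.Ventures.CertifiedArithmetic.LowPrec.SR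
open Finset STree

/-- **OCP FP6 E3M2: TREE 6, J 4, PROD 4, IP1 10, IP2 6.** -/
theorem e3m2_thresholds : Thresholds Format.E3M2 6 4 4 10 6 :=
  valueSet_thresholds_exact _ _ _ _ _ _ (by decide) (by decide) (by decide) (by decide) (by decide)
    (by decide) (by decide) (by decide)

/-- **OCP FP6 E2M3: TREE 2, J 3, PROD 4, IP1 5, IP2 4** — the product rounding (normal term
`m + 1 = 4`) binds the two-stage threshold. -/
theorem e2m3_thresholds : Thresholds Format.E2M3 2 3 4 5 4 :=
  valueSet_thresholds_exact _ _ _ _ _ _ (by decide) (by decide) (by decide) (by decide) (by decide)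
    (by decide) (by decide) (by decide)

set_option maxRecDepth 8192 in
/-- **IEEE binary16: TREE 29, J 24, PROD 24, IP1 53, IP2 29.** -/
theorem binary16_thresholds : Thresholds Format.Binary16 29 24 24 53 29 :=
  valueSet_thresholds_exact _ _ _ _ _ _ (by decide) (by decide) (by decide) (by decide) (by decide)
    (by decide) (by decide) (by decide)

set_option maxRecDepth 8192 in
/-- **bfloat16: TREE 253, J 133, PROD 133, IP1 386, IP2 253.** -/
theorem bfloat16_thresholds : Thresholds Format.BFloat16 253 133 133 386 253 :=
  valueSet_thresholds_exact _ _ _ _ _ _ (by decide) (by decide) (by decide) (by decide) (by decide)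
    (by decide) (by decide) (by decide)

set_option maxRecDepth 8192 in
/-- **IEEE binary32: TREE 253, J 149, PROD 149, IP1 402, IP2 253.** -/
theorem binary32_thresholds : Thresholds Format.Binary32 253 149 149 402 253 :=
  valueSet_thresholds_exact _ _ _ _ _ _ (by decide) (by decide) (by decide) (by decide) (by decide)
    (by decide) (by decide) (by decide)

/-- **What a `Thresholds` row says operationally** (reading lemma): from the packaged statement, at
`N ≥ I₂` bits every two-stage inner product of format vectors has, under each of the three P3109
rules, exactly the expectation profile of exact SR, while one bit short `probAwayA` vanishes at the
pair `−maxRat + quantum` (`L − 1` bits) and at `quantum²` (`J − 1` bits), both of positive exact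
up-probability — i.e. (erratum E1, files LXXXVIII/LXXXIX) at the NEGATIVE pair rule `A` rounds up
twice too often and rules `B`, `C` never, at the positive `quantum²` rule `A` never rounds up: the
thresholds are attained, not merely sufficient. -/
theorem Thresholds.attained {φ : Format} {L J P I₁ I₂ : ℕ} (h : Thresholds φ L J P I₁ I₂) :
    (0 < pUp (valueSet φ) (-φ.maxRat + φ.quantum) ∧
      probAwayA (L - 1) (pUp (valueSet φ) (-φ.maxRat + φ.quantum)) = 0) ∧
    (0 < pUp (valueSet φ) (φ.quantum * φ.quantum) ∧
      probAwayA (J - 1) (pUp (valueSet φ) (φ.quantum * φ.quantum)) = 0) ∧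
    (0 < pUp (valueSet φ) (-φ.maxRat + φ.quantum * φ.quantum) ∧
      probAwayA (I₁ - 1) (pUp (valueSet φ) (-φ.maxRat + φ.quantum * φ.quantum)) = 0) := by
  obtain ⟨-, ⟨hv, -, hA⟩, -, ⟨hw, -, hAw⟩, -, ⟨hv', -, hA'⟩, -⟩ := h
  exact ⟨⟨by rw [hv]; positivity, hA⟩, ⟨by rw [hw]; positivity, hAw⟩, ⟨by rw [hv']; positivity, hA'⟩⟩

/-- The table's threshold arithmetic from the `Format` records (`L`, `J`, `P`, `I₁`, `I₂`),
kernel-checked. -/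
theorem threshold_table_values :
    (Format.E3M2.emaxCode - 1 = 6 ∧ Format.E3M2.bias + Format.E3M2.manBits - 1 = 4 ∧
      max (Format.E3M2.manBits + 1) 4 = 4 ∧ 6 + 4 = 10 ∧ max 6 4 = 6) ∧
    (Format.E2M3.emaxCode - 1 = 2 ∧ Format.E2M3.bias + Format.E2M3.manBits - 1 = 3 ∧
      max (Format.E2M3.manBits + 1) 3 = 4 ∧ 2 + 3 = 5 ∧ max 2 4 = 4) ∧
    (Format.Binary16.emaxCode - 1 = 29 ∧ Format.Binary16.bias + Format.Binary16.manBits - 1 = 24 ∧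
      max (Format.Binary16.manBits + 1) 24 = 24 ∧ 29 + 24 = 53 ∧ max 29 24 = 29) ∧
    (Format.BFloat16.emaxCode - 1 = 253 ∧
      Format.BFloat16.bias + Format.BFloat16.manBits - 1 = 133 ∧
      max (Format.BFloat16.manBits + 1) 133 = 133 ∧ 253 + 133 = 386 ∧ max 253 133 = 253) ∧
    (Format.Binary32.emaxCode - 1 = 253 ∧
      Format.Binary32.bias + Format.Binary32.manBits - 1 = 149 ∧
      max (Format.Binary32.manBits + 1) 149 = 149 ∧ 253 + 149 = 402 ∧ max 253 149 = 253) := by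
  decide

end Summit.Ventures.CertifiedArithmetic.LowPrec.SR.LimitedBits
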